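import Summits.KontsevichZagierPeriods.KontsevichZagierPeriods.Theorems.RootDecompZetaThreeFrontierRungFourPreludeP04

/-! # `RootDecompZetaThreeFrontierRungFourPreludeP05` — part 5/14 of the mechanical ≤400-line split of `pre_src.lean` (sha256 ba362a5194d75c20…)
Source: decomp-kz lens-1 g12/g13 rung-4 prelude = Prelude_v3.lean @ba362a51 (Basis22_v1 sections RotFour/Shuffle/ProdFour/GenFb/WordMoves/RungFour/Basis22 + FacetGeneric_v2 §1–§23; critic CLEARED g6 row 330 / g6-20 l.1368); --supports stmt-KontsevichZagierPeriods-27141.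
Split by census-1 g10 `gen/splitlean.py`: scopes re-opened with their `open`/`variable`/`set_option` context; mathematics and declaration order unchanged. -/

set_option linter.dupNamespace false
noncomputable section
namespace Summit.KontsevichZagierPeriods.KontsevichZagierPeriods.Cruxes.GZNormalFormWThree.GZLadder.ProdFour
open Set MeasureTheory MvPolynomial
open Literature.NumberTheory.Transcendental
open Literature.ModelTheory.ExponentialFields

open Set MeasureTheory MvPolynomial in
open Literature.NumberTheory.Transcendental in
open Literature.ModelTheory.ExponentialFields in
/-- Auxiliary step `mem_Δ4`: mem Δ4. [bookkeeping] -/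
private theorem mem_Δ4 (t : Fin 4 → ℝ) :
    t ∈ KZ.openOrderedSimplex 4 ↔ 0 < t 3 ∧ t 3 < t 2 ∧ t 2 < t 1 ∧ t 1 < t 0 ∧ t 0 < 1 := by
  constructor
  · rintro ⟨h0, h1, ha⟩
    exact ⟨h0 3, ha (show (2 : Fin 4) < 3 by decide), ha (show (1 : Fin 4) < 2 by decide),
      ha (show (0 : Fin 4) < 1 by decide), h1 0⟩
  · rintro ⟨h3, h32, h21, h10, h0⟩
    have hsa : StrictAnti t := by
      refine Fin.strictAnti_iff_succ_lt.mpr fun i => ?_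
      fin_cases i
      · simpa using h10
      · simpa using h21
      · simpa using h32
    exact ⟨fun i => lt_of_lt_of_le h3 (hsa.antitone (Fin.le_last i)),
      fun i => lt_of_le_of_lt (hsa.antitone (Fin.le_iff_val_le_val.2 (Nat.zero_le _))) h0, hsa⟩

/-- Auxiliary step `mapB_zero`: map B zero. [bookkeeping] -/
theorem mapB_zero (p : Fin 4 → ℝ) : mapB p 0 = p 0 := rfl
/-- Auxiliary step `mapB_one`: map B one. [bookkeeping] -/
theorem mapB_one (p : Fin 4 → ℝ) : mapB p 1 = p 1 + p 2 * (p 0 - p 1) := rfl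
/-- Auxiliary step `mapB_two`: map B two. [bookkeeping] -/
theorem mapB_two (p : Fin 4 → ℝ) : mapB p 2 = p 1 + p 3 * (p 0 - p 1) := rfl
/-- Auxiliary step `mapB_three`: map B three. [bookkeeping] -/
theorem mapB_three (p : Fin 4 → ℝ) : mapB p 3 = p 1 := rfl

/-- Auxiliary definition `invB`: inv B. [bookkeeping] -/
def invB (t : Fin 4 → ℝ) : Fin 4 → ℝ := ![t 0, t 3, (t 1 - t 3) / (t 0 - t 3), (t 2 - t 3) / (t 0 - t 3)]

/-- Auxiliary step `mapB_mem`: map B mem. [bookkeeping] -/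
theorem mapB_mem {p : Fin 4 → ℝ} (hp : p ∈ dom22) : mapB p ∈ KZ.openOrderedSimplex 4 := by
  obtain ⟨h10, h0, h1, h32, h2, h3⟩ := hp
  have hd : 0 < p 0 - p 1 := sub_pos.2 h10
  rw [mem_Δ4, mapB_zero, mapB_one, mapB_two, mapB_three]
  refine ⟨h1, by nlinarith [mul_pos h3 hd], by nlinarith [mul_lt_mul_of_pos_right h32 hd], ?_, h0⟩
  nlinarith [mul_lt_mul_of_pos_right h2 hd]

/-- Auxiliary step `invB_mem`: inv B mem. [bookkeeping] -/
theorem invB_mem {t : Fin 4 → ℝ} (ht : t ∈ KZ.openOrderedSimplex 4) : invB t ∈ dom22 := by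
  obtain ⟨h3, h32, h21, h10, h0⟩ := (mem_Δ4 t).1 ht
  have hd : 0 < t 0 - t 3 := by linarith
  simp only [mem_dom22_iff, invB, Matrix.cons_val_zero, Matrix.cons_val_one, Matrix.head_cons,
    Matrix.cons_val_two, Matrix.tail_cons, Matrix.cons_val_three]
  refine ⟨by linarith, h0, h3, div_lt_div_of_pos_right (by linarith) hd, by rw [div_lt_one hd]; linarith,
    div_pos (by linarith) hd⟩

/-- Auxiliary step `mapB_invB`: map B inv B. [bookkeeping] -/
theorem mapB_invB {t : Fin 4 → ℝ} (ht : t ∈ KZ.openOrderedSimplex 4) : mapB (invB t) = t := by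
  obtain ⟨h3, h32, h21, h10, h0⟩ := (mem_Δ4 t).1 ht
  have hd : t 0 - t 3 ≠ 0 := by linarith
  funext i
  fin_cases i
  · simp [mapB, invB]
  · simp [mapB, invB]; field_simp; ring
  · simp [mapB, invB]; field_simp; ring
  · simp [mapB, invB]

/-- Auxiliary step `invB_mapB`: inv B map B. [bookkeeping] -/
theorem invB_mapB {p : Fin 4 → ℝ} (hp : p ∈ dom22) : invB (mapB p) = p := by
  have hd : p 0 - p 1 ≠ 0 := (sub_pos.2 hp.1).ne'
  funext i
  fin_cases i
  · simp [mapB, invB]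
  · simp [mapB, invB]
  · simp [mapB, invB]; field_simp
  · simp [mapB, invB]; field_simp

/-- Auxiliary step `image_mapB`: image map B. [bookkeeping] -/
theorem image_mapB : mapB '' dom22 = KZ.openOrderedSimplex 4 := by
  ext t
  constructor
  · rintro ⟨p, hp, rfl⟩; exact mapB_mem hp
  · intro ht; exact ⟨invB t, invB_mem ht, mapB_invB ht⟩

/-- Auxiliary step `injOn_mapB`: inj On map B. [bookkeeping] -/
theorem injOn_mapB : InjOn mapB dom22 :=
  fun p hp q hq h => by rw [← invB_mapB hp, ← invB_mapB hq, h]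

/-- Auxiliary step `isSemialgebraicMapOn_mapB`: is Semialgebraic Map On map B. [bookkeeping] -/
theorem isSemialgebraicMapOn_mapB : IsSemialgebraicMapOn ℚ dom22 mapB :=
  (isSemialgebraicMapOn_aeval isSemialgebraic_dom22
    ![X 0, X 1 + X 2 * (X 0 - X 1), X 1 + X 3 * (X 0 - X 1), (X 1 : MvPolynomial (Fin 4) ℚ)]).congr
    fun p _ => by
      funext j
      fin_cases j <;> simp [mapB_zero, mapB_one, mapB_two, mapB_three]

/-- `D(q ↦ q 1 + q j * (q 0 - q 1))` at `p` in the shape produced by `HasFDerivAt.add/mul/sub` -/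
def dB (p : Fin 4 → ℝ) (j : Fin 4) : (Fin 4 → ℝ) →L[ℝ] ℝ :=
  Pj 1 + (p j • (Pj 0 - Pj 1) + (p 0 - p 1) • Pj j)

/-- Auxiliary step `hasFDerivAt_dB`: has FDeriv At d B. [bookkeeping] -/
theorem hasFDerivAt_dB (p : Fin 4 → ℝ) (j : Fin 4) :
    HasFDerivAt (fun q : Fin 4 → ℝ => q 1 + q j * (q 0 - q 1)) (dB p j) p :=
  (hasFDerivAt_coord 1 p).add ((hasFDerivAt_coord j p).mul ((hasFDerivAt_coord 0 p).sub (hasFDerivAt_coord 1 p)))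

/-- Auxiliary step `dB_apply`: d B apply. [bookkeeping] -/
theorem dB_apply (p h : Fin 4 → ℝ) (j : Fin 4) : dB p j h = h 1 + (p j * (h 0 - h 1) + (p 0 - p 1) * h j) := by
  simp [dB]

/-- Auxiliary definition `rowB`: row B. [bookkeeping] -/
def rowB (p : Fin 4 → ℝ) : Fin 4 → ((Fin 4 → ℝ) →L[ℝ] ℝ) := ![Pj 0, dB p 2, dB p 3, Pj 1]

/-- Auxiliary definition `LB`: LB. [bookkeeping] -/
def LB (p : Fin 4 → ℝ) : (Fin 4 → ℝ) →L[ℝ] (Fin 4 → ℝ) := ContinuousLinearMap.pi (rowB p)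

/-- Auxiliary step `LB_apply`: LB apply. [bookkeeping] -/
theorem LB_apply (p h : Fin 4 → ℝ) (i : Fin 4) : LB p h i = rowB p i h := rfl

/-- Auxiliary step `hasFDerivAt_mapB`: has FDeriv At map B. [bookkeeping] -/
theorem hasFDerivAt_mapB (p : Fin 4 → ℝ) : HasFDerivAt mapB (LB p) p := by
  have key : HasFDerivAt (fun q : Fin 4 → ℝ => fun i =>
      (![q 0, q 1 + q 2 * (q 0 - q 1), q 1 + q 3 * (q 0 - q 1), q 1] : Fin 4 → ℝ) i)
      (ContinuousLinearMap.pi (rowB p)) p := by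
    refine hasFDerivAt_pi.2 fun i => ?_
    fin_cases i
    · simpa [rowB] using hasFDerivAt_coord 0 p
    · simpa [rowB] using hasFDerivAt_dB p 2
    · simpa [rowB] using hasFDerivAt_dB p 3
    · simpa [rowB] using hasFDerivAt_coord 1 p
  exact key

/-- Auxiliary definition `MB`: MB. [bookkeeping] -/
def MB (p : Fin 4 → ℝ) : Matrix (Fin 4) (Fin 4) ℝ :=
  !![1, 0, 0, 0; p 2, 1 - p 2, p 0 - p 1, 0; p 3, 1 - p 3, 0, p 0 - p 1; 0, 1, 0, 0]

/-- Auxiliary step `LB_eq_toLin'`: LB eq to Lin'. [bookkeeping] -/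
theorem LB_eq_toLin' (p : Fin 4 → ℝ) :
    (LB p : (Fin 4 → ℝ) →ₗ[ℝ] (Fin 4 → ℝ)) = Matrix.toLin' (MB p) := by
  apply LinearMap.ext
  intro h
  rw [Matrix.toLin'_apply, ContinuousLinearMap.coe_coe]
  funext i
  rw [LB_apply]
  fin_cases i
  · simp [rowB, MB, Matrix.mulVec, dotProduct, Fin.sum_univ_four]
  · simp [rowB, MB, Matrix.mulVec, dotProduct, Fin.sum_univ_four, dB_apply]; ring
  · simp [rowB, MB, Matrix.mulVec, dotProduct, Fin.sum_univ_four, dB_apply]; ring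
  · simp [rowB, MB, Matrix.mulVec, dotProduct, Fin.sum_univ_four]

/-- Auxiliary step `det_MB`: det MB. [bookkeeping] -/
theorem det_MB (p : Fin 4 → ℝ) : (MB p).det = (p 0 - p 1) ^ 2 := by
  rw [Matrix.det_succ_row_zero]
  simp [MB, Fin.sum_univ_succ, Matrix.det_fin_three, Fin.succAbove]
  ring

/-- Auxiliary step `abs_det_LB`: abs det LB. [bookkeeping] -/
theorem abs_det_LB {p : Fin 4 → ℝ} (_hp : p ∈ dom22) : |(LB p).det| = (p 0 - p 1) ^ 2 := by
  have : (LB p).det = (p 0 - p 1) ^ 2 := by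
    show LinearMap.det (LB p : (Fin 4 → ℝ) →ₗ[ℝ] (Fin 4 → ℝ)) = _
    rw [LB_eq_toLin', LinearMap.det_toLin', det_MB]
  rw [this, abs_of_nonneg (sq_nonneg _)]

/-- **THE SINGLE-CELL PRODUCT CHART `Φ_B`, PROVED**: `[Δ₂×Δ₂, (f ∘ Φ_B)·(a₀−a₁)²] ≡ [Δ₄, f]`. -/
theorem prodB_rel (r r' : KZ.IntegralRep 4) (hr : r.domain = dom22) (hr' : r'.domain = KZ.openOrderedSimplex 4)
    (h : ∀ p ∈ dom22, r.integrand p = r'.integrand (mapB p) * (p 0 - p 1) ^ 2) :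
    KZ.of r - KZ.of r' ∈ KZ.relations := by
  refine chart_rel r r' (by rw [hr]; exact isSemialgebraicMapOn_mapB) hasFDerivAt_mapB
    (by rw [hr]; exact injOn_mapB) (fun p hp => abs_det_LB (by rw [← hr]; exact hp))
    (by rw [hr, image_mapB, hr']) fun p hp => h p (by rw [← hr]; exact hp)

/-- `Φ_B`: `f ∈ L¹(Δ₄) ↔ (f ∘ Φ_B) · (a₀−a₁)² ∈ L¹(Δ₂ × Δ₂)` -/
theorem integrableOn_pullB_iff (f : (Fin 4 → ℝ) → ℝ) :
    IntegrableOn f (KZ.openOrderedSimplex 4) ↔ IntegrableOn (fun p => f (mapB p) * (p 0 - p 1) ^ 2) dom22 := by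
  rw [← image_mapB, integrableOn_image_iff_integrableOn_abs_det_fderiv_smul (μ := volume) measurableSet_dom22
    (fun x _ => (hasFDerivAt_mapB x).hasFDerivWithinAt) injOn_mapB f]
  exact integrableOn_congr_fun (fun p hp => by rw [abs_det_LB hp, smul_eq_mul, mul_comm]) measurableSet_dom22

/-- the 22nd basis element of the convergent space (RUNG4 §19): `F_b = 1/(t₀ (1−t₃)(t₁−t₃)(t₀−t₂))` -/
def Fb (t : Fin 4 → ℝ) : ℝ := 1 / (t 0 * (1 - t 3) * (t 1 - t 3) * (t 0 - t 2))

/-- the `ζ(2) ⊗ ζ(2)` product integrand on `Δ₂ × Δ₂` -/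
def zeta22 (p : Fin 4 → ℝ) : ℝ := 1 / (p 0 * (1 - p 1)) * (1 / (p 2 * (1 - p 3)))

/-- **`Φ_B^* (F_b dt) = ω_{ζ(2)} ⊗ ω_{ζ(2)}`** on `Δ₂ × Δ₂`. -/
theorem Fb_mapB {p : Fin 4 → ℝ} (hp : p ∈ dom22) : Fb (mapB p) * (p 0 - p 1) ^ 2 = zeta22 p := by
  obtain ⟨h10, h0, h1, h32, h2, h3⟩ := hp
  have hd : p 0 - p 1 ≠ 0 := (sub_pos.2 h10).ne'
  have ha0 : p 0 ≠ 0 := by linarith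
  have ha1 : 1 - p 1 ≠ 0 := by linarith
  have hb0 : p 2 ≠ 0 := by linarith
  have hb1 : 1 - p 3 ≠ 0 := by linarith
  have e1 : p 1 + p 2 * (p 0 - p 1) - p 1 = p 2 * (p 0 - p 1) := by ring
  have e2 : p 0 - (p 1 + p 3 * (p 0 - p 1)) = (1 - p 3) * (p 0 - p 1) := by ring
  simp only [Fb, zeta22, mapB_zero, mapB_one, mapB_two, mapB_three, e1, e2]
  field_simp

/-- **`[Δ₄, F_b] ≡ [Δ₂×Δ₂, ω_{ζ(2)} ⊗ ω_{ζ(2)}]`** for any representations with these domains/integrands. -/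
theorem Fb_rel (r r' : KZ.IntegralRep 4) (hr : r.domain = dom22) (hr' : r'.domain = KZ.openOrderedSimplex 4)
    (hri : EqOn r.integrand zeta22 dom22) (hr'i : EqOn r'.integrand Fb (KZ.openOrderedSimplex 4)) :
    KZ.of r - KZ.of r' ∈ KZ.relations :=
  prodB_rel r r' hr hr' fun p hp => by rw [hri hp, hr'i (mapB_mem hp), Fb_mapB hp]

/-- integrability of `F_b` on `Δ₄` from integrability of the product integrand on `Δ₂ × Δ₂`
(the latter is `(w.prod w).integrableOn` for the `ζ(2)` simplex representation `w`). -/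
theorem integrableOn_Fb (h : IntegrableOn zeta22 dom22) : IntegrableOn Fb (KZ.openOrderedSimplex 4) :=
  (integrableOn_pullB_iff Fb).2 (h.congr_fun (fun _ hp => (Fb_mapB hp).symm) measurableSet_dom22)

end Summit.KontsevichZagierPeriods.KontsevichZagierPeriods.Cruxes.GZNormalFormWThree.GZLadder.ProdFour

namespace Summit.KontsevichZagierPeriods.KontsevichZagierPeriods.Cruxes.GZNormalFormWThree.GZLadder.GenFb

open Set MeasureTheory MvPolynomial
open Literature.NumberTheory.Transcendental
open Literature.ModelTheory.ExponentialFields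
open Summit.KontsevichZagierPeriods.KontsevichZagierPeriods.Cruxes.GZNormalFormWThree.GZLadder.Shuffle
  (topWords congInto_words_four_of_two_two)
open Summit.KontsevichZagierPeriods.KontsevichZagierPeriods.Cruxes.GZNormalFormWThree.GZLadder.ProdFour
  (dom22 mem_dom22_iff mapB mapB_mem mapB_zero mapB_one mapB_two mapB_three Fb zeta22 Fb_mapB prodB_rel integrableOn_Fb measurableSet_dom22)

/-! ## §C  `[Δ₄, c·F_b]` exists and is congruent into `words 4` -/

/-- Auxiliary step `mem_Δ2` (§C): mem Δ2. [bookkeeping] -/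
private theorem mem_Δ2 (a : Fin 2 → ℝ) : a ∈ KZ.openOrderedSimplex 2 ↔ 0 < a 1 ∧ a 1 < a 0 ∧ a 0 < 1 := by
  constructor
  · rintro ⟨h0, h1, ha⟩
    exact ⟨h0 1, ha (show (0 : Fin 2) < 1 by decide), h1 0⟩
  · rintro ⟨h1, h10, h0⟩
    have hsa : StrictAnti a := by
      refine Fin.strictAnti_iff_succ_lt.mpr fun i => ?_
      fin_cases i
      simpa using h10
    refine ⟨fun i => ?_, fun i => ?_, hsa⟩
    · fin_cases i
      · exact h1.trans h10
      · exact h1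
    · fin_cases i
      · exact h0
      · exact h10.trans h0

/-- the product domain of two `Δ₂`-representations is `dom22` -/
theorem prodDomain_eq_dom22 (w w' : KZ.IntegralRep 2) (hw : w.domain = KZ.openOrderedSimplex 2)
    (hw' : w'.domain = KZ.openOrderedSimplex 2) : KZ.IntegralRep.prodDomain w w' = dom22 := by
  ext z
  rw [KZ.IntegralRep.mem_prodDomain, hw, hw', mem_Δ2, mem_Δ2, mem_dom22_iff]
  show (0 < z 1 ∧ z 1 < z 0 ∧ z 0 < 1) ∧ (0 < z 3 ∧ z 3 < z 2 ∧ z 2 < 1) ↔ _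
  tauto

/-- transitivity of congruence through a relation -/
private theorem congInto_of_sub_mem {T : Set KZ.FormalRep} {x m : KZ.FormalRep} (h : x - m ∈ KZ.relations)
    (hm : CongInto T m) : CongInto T x := by
  obtain ⟨m', hm', h'⟩ := hm
  refine ⟨m', hm', ?_⟩
  have key := add_mem h h'
  rwa [sub_add_sub_cancel] at key

/-- the representation `[Δ₄, c · F_b]` (integrability transported from `Δ₂ × Δ₂` along `Φ_B`) -/
def FbRep (c : ℚ) (hint : IntegrableOn zeta22 dom22) : KZ.IntegralRep 4 where
  domain := KZ.openOrderedSimplex 4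
  integrand := fun t => (c : ℝ) * Fb t
  isSemialgebraic_domain := KZ.isSemialgebraic_openOrderedSimplex 4
  isSemialgebraicFunOn_integrand := by
    refine (isSemialgebraicFunOn_aeval_div_aeval (KZ.isSemialgebraic_openOrderedSimplex 4)
      (C c : MvPolynomial (Fin 4) ℚ) (X 0 * (C 1 - X 3) * (X 1 - X 3) * (X 0 - X 2))
      fun t ht => ?_).congr fun t _ => ?_
    · obtain ⟨h3, h32, h21, h10, h0⟩ := (RotFour.mem_simplex_four_iff t).1 ht
      have h1 : t 0 ≠ 0 := by linarith
      have h2 : (1 : ℝ) - t 3 ≠ 0 := by linarith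
      have h4 : t 1 - t 3 ≠ 0 := by linarith
      have h5 : t 0 - t 2 ≠ 0 := by linarith
      simp only [map_mul, map_sub, MvPolynomial.aeval_X, map_one]
      exact mul_ne_zero (mul_ne_zero (mul_ne_zero h1 h2) h4) h5
    · simp only [Fb, map_mul, map_sub, MvPolynomial.aeval_X, MvPolynomial.aeval_C, map_one, eq_ratCast]
      ring
  integrableOn := (integrableOn_Fb hint).const_mul (c : ℝ)

/-- Auxiliary step `FbRep_domain` (§C): Fb Rep domain. [bookkeeping] -/
theorem FbRep_domain (c : ℚ) (hint : IntegrableOn zeta22 dom22) :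
    (FbRep c hint).domain = KZ.openOrderedSimplex 4 := rfl

/-- Auxiliary step `FbRep_integrand` (§C): Fb Rep integrand. [bookkeeping] -/
theorem FbRep_integrand (c : ℚ) (hint : IntegrableOn zeta22 dom22) (t : Fin 4 → ℝ) :
    (FbRep c hint).integrand t = (c : ℝ) * Fb t := rfl

/-- **GENERATOR 22 AS A MOVE.**  Given the `ζ(2)` word representations `[Δ₂, c/(a₀(1−a₁))]` (all `c : ℚ`), for every
`c` the representation `[Δ₄, c · F_b]` exists and is congruent, modulo the KZ moves, into `words 4`. -/
theorem basisMove_Fb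
    (hw : ∀ c : ℚ, ∃ w : KZ.IntegralRep 2, w.domain = KZ.openOrderedSimplex 2 ∧
      EqOn w.integrand (fun a => (c : ℝ) * (1 / (a 0 * (1 - a 1)))) w.domain ∧ KZ.of w ∈ topWords 2)
    (c : ℚ) :
    ∃ r : KZ.IntegralRep 4, r.domain = KZ.openOrderedSimplex 4 ∧
      EqOn r.integrand (fun t => (c : ℝ) * Fb t) (KZ.openOrderedSimplex 4) ∧ CongInto (words 4) (KZ.of r) := by
  obtain ⟨w1, hw1d, hw1i, hw1T⟩ := hw 1
  obtain ⟨wc, hwcd, hwci, hwcT⟩ := hw c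
  have hd1 : (w1.prod w1).domain = dom22 := by
    rw [KZ.IntegralRep.prod_domain, prodDomain_eq_dom22 w1 w1 hw1d hw1d]
  have hdc : (wc.prod w1).domain = dom22 := by
    rw [KZ.IntegralRep.prod_domain, prodDomain_eq_dom22 wc w1 hwcd hw1d]
  -- the components of a point of `dom22` lie in `Δ₂`
  have hcomp : ∀ z : Fin 4 → ℝ, z ∈ dom22 →
      (fun i : Fin 2 => z (Fin.castAdd 2 i)) ∈ KZ.openOrderedSimplex 2 ∧
      (fun j : Fin 2 => z (Fin.natAdd 2 j)) ∈ KZ.openOrderedSimplex 2 := by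
    intro z hz
    have h := (KZ.IntegralRep.mem_prodDomain w1 w1 z).1
      (by rw [prodDomain_eq_dom22 w1 w1 hw1d hw1d]; exact hz)
    rw [hw1d] at h
    exact h
  -- integrability of `ω ⊗ ω` on `Δ₂ × Δ₂` from the product representation
  have hint : IntegrableOn zeta22 dom22 := by
    have h := (w1.prod w1).integrableOn
    rw [hd1] at h
    refine h.congr_fun (fun z hz => ?_) measurableSet_dom22
    obtain ⟨hz1, hz2⟩ := hcomp z hz
    rw [KZ.IntegralRep.prod_integrand_eq, KZ.IntegralRep.prodFun_apply, hw1i (hw1d ▸ hz1), hw1i (hw1d ▸ hz2)]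
    simp [zeta22]
  refine ⟨FbRep c hint, rfl, fun t _ => rfl, ?_⟩
  -- rule 2 along Φ_B: [Δ₂×Δ₂, (c ω) ⊗ ω] − [Δ₄, c F_b] ∈ relations
  have hrel : KZ.of (wc.prod w1) - KZ.of (FbRep c hint) ∈ KZ.relations := by
    refine prodB_rel (wc.prod w1) (FbRep c hint) hdc rfl fun p hp => ?_
    obtain ⟨hp1, hp2⟩ := hcomp p hp
    rw [KZ.IntegralRep.prod_integrand_eq, KZ.IntegralRep.prodFun_apply, hwci (hwcd ▸ hp1), hw1i (hw1d ▸ hp2),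
      FbRep_integrand, show (c : ℝ) * Fb (mapB p) * (p 0 - p 1) ^ 2 = (c : ℝ) * (Fb (mapB p) * (p 0 - p 1) ^ 2) by ring,
      Fb_mapB hp]
    simp [zeta22]
    ring
  have hrel' : KZ.of (FbRep c hint) - KZ.of (wc.prod w1) ∈ KZ.relations := by
    have := neg_mem hrel
    rwa [neg_sub] at this
  refine congInto_of_sub_mem hrel' ?_
  rw [← KZ.of_mul_of]
  exact congInto_words_four_of_two_two hwcT hw1T

/-! ## §D  The scaled `ζ(2)` word representations `[Δ₂, c/(a₀(1−a₁))]` (discharging the hypothesis of `basisMove_Fb`) -/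

/-- Auxiliary step `isAdmissible_two` (§D): is Admissible two. [bookkeeping] -/
private theorem isAdmissible_two : MZV.IsAdmissible [2] :=
  ⟨fun i hi => by simp at hi; omega, fun _ => by simp⟩

/-- integrability of the `ζ(2)` form on `Δ₂`, from the Literature fact `KZ.mzvIntegrand_integrableOn_holds` -/
theorem integrableOn_zeta2 : IntegrableOn (fun a : Fin 2 → ℝ => 1 / (a 0 * (1 - a 1))) (KZ.openOrderedSimplex 2) := by
  have h : IntegrableOn (fun a : Fin 2 → ℝ => ∏ i : Fin 2, KZ.mzvForm ((MZV.binaryWord [2]).getD i false) (a i))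
      (KZ.openOrderedSimplex 2) volume :=
    KZ.mzvIntegrand_integrableOn_holds [2] isAdmissible_two
  refine h.congr_fun (fun a _ => ?_) (KZ.measurableSet_openOrderedSimplex 2)
  show (∏ i : Fin 2, KZ.mzvForm ((MZV.binaryWord [2]).getD i false) (a i)) = 1 / (a 0 * (1 - a 1))
  rw [Fin.prod_univ_two]
  simp [MZV.binaryWord, KZ.mzvForm]
  ring

/-- the representation `[Δ₂, c · ω_{ζ(2)}]` -/
def zeta2Rep (c : ℚ) : KZ.IntegralRep 2 where
  domain := KZ.openOrderedSimplex 2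
  integrand := fun a => (c : ℝ) * (1 / (a 0 * (1 - a 1)))
  isSemialgebraic_domain := KZ.isSemialgebraic_openOrderedSimplex 2
  isSemialgebraicFunOn_integrand := by
    refine (isSemialgebraicFunOn_aeval_div_aeval (KZ.isSemialgebraic_openOrderedSimplex 2)
      (C c : MvPolynomial (Fin 2) ℚ) (X 0 * (C 1 - X 1)) fun a ha => ?_).congr fun a _ => ?_
    · obtain ⟨h1, h10, h0⟩ := (mem_Δ2 a).1 ha
      have ha0 : a 0 ≠ 0 := by linarith
      have ha1 : (1 : ℝ) - a 1 ≠ 0 := by linarith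
      simp only [map_mul, map_sub, MvPolynomial.aeval_X, map_one]
      exact mul_ne_zero ha0 ha1
    · simp only [map_mul, map_sub, MvPolynomial.aeval_X, MvPolynomial.aeval_C, map_one, eq_ratCast]
      ring
  integrableOn := integrableOn_zeta2.const_mul (c : ℝ)

/-- Auxiliary step `zeta2Rep_mem_topWords` (§D): zeta2 Rep mem top Words. [bookkeeping] -/
theorem zeta2Rep_mem_topWords (c : ℚ) : KZ.of (zeta2Rep c) ∈ topWords 2 := by
  refine ⟨![false, true], c, zeta2Rep c, rfl, fun a _ => ?_, rfl⟩
  show (c : ℝ) * (1 / (a 0 * (1 - a 1))) = (c : ℝ) * ∏ i : Fin 2, (if (![false, true] : Fin 2 → Bool) i then 1 / (1 - a i) else 1 / a i)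
  simp only [Fin.prod_univ_two, Matrix.cons_val_zero, Matrix.cons_val_one, Bool.false_eq_true,
    if_false, if_true]
  rw [one_div_mul_one_div]

/-- the hypothesis of `basisMove_Fb`, discharged -/
theorem zeta2_words : ∀ c : ℚ, ∃ w : KZ.IntegralRep 2, w.domain = KZ.openOrderedSimplex 2 ∧
    EqOn w.integrand (fun a => (c : ℝ) * (1 / (a 0 * (1 - a 1)))) w.domain ∧ KZ.of w ∈ topWords 2 :=
  fun c => ⟨zeta2Rep c, rfl, fun _ _ => rfl, zeta2Rep_mem_topWords c⟩

/-- **GENERATOR 22, UNCONDITIONALLY**: for every `c : ℚ`, `[Δ₄, c · F_b]` exists and is congruent into `words 4`. -/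
theorem basisMove_Fb' (c : ℚ) : ∃ r : KZ.IntegralRep 4, r.domain = KZ.openOrderedSimplex 4 ∧
    EqOn r.integrand (fun t => (c : ℝ) * Fb t) (KZ.openOrderedSimplex 4) ∧ CongInto (words 4) (KZ.of r) :=
  basisMove_Fb zeta2_words c

end Summit.KontsevichZagierPeriods.KontsevichZagierPeriods.Cruxes.GZNormalFormWThree.GZLadder.GenFb

namespace Summit.KontsevichZagierPeriods.KontsevichZagierPeriods.Cruxes.GZNormalFormWThree.GZLadder.WordMoves

end Summit.KontsevichZagierPeriods.KontsevichZagierPeriods.Cruxes.GZNormalFormWThree.GZLadder.WordMoves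
end
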